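import Summits.Ventures.Crystal3D.Theorems.StickyWulffConstantNoReconstructionGainFourFamilyPlug
import Summits.Ventures.Crystal3D.Theorems.StickyWulffConstantNoReconstructionGainFourFamilyDirs
import Summits.Ventures.Crystal3D.Theorems.StickyWulffConstantNoReconstructionGainSlabFormLevel
import HarnessLib

/-!
# Every film on the refined lattice `(1/3)Λ₀` (all four `{111}` families at once) satisfies the atom

HONEST FRAMING. Part of the venture `Summits/Ventures/Crystal3D` (cell `crystal3d-full`), helper
`--supports` the crux `NoReconstructionGain` (stmt-Ventures-19144, route
`route-Ventures-StickyWulffConstant`), line `adhesion`; census class (ii).  Assembly of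
`…FourFamilyLocal` (clique rule, six conflict triples), `…FourFamilyPlug` (plug exclusion),
`…FourFamilyDirs` (the 36 unit vectors of `(1/3)Λ₀`) with `adhesion_of_flow` and the level-inclusive rim
reduction.

THE CERTIFICATE.  `A18` = the 18 cost-2 directions of the fundamental chamber (6 kissing vectors
`h₁..h₆` + 12 twin vectors); transfer `t(x, y) = s(x − y) − s(y − x)`, `s` the indicator of `A18`
(antisymmetric, `≤ 1`, position independent, the SAME at lattice and twin balls).  At a film ball `q`
every partner direction is one of the 36 unit vectors of `(1/3)Λ₀` (`third_unit_mem`); those in `A18`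
fall in six pairwise-conflicting triples, so at most six partners cost `2` (`cliqueRule_T2`); the
others lie in `−A18` and cost `0` — unless the partner is a substrate ball, which is impossible: a
plug at `q + d`, `d ∈ −A18`, forces (closure of the substrate under the six heads) the substrate ball
`q + d + e` at distance `‖d + e‖ < 1` from `q` (`fourFamilyChamber_plugExclusion`).  The normal `ν`
enters ONLY through that closure, i.e. through `⟪hᵢ, ν⟫ ≤ 0` for the six heads (a closed cone, one
twenty-fourth of the sphere: cubic components `a₁ ≥ a₂ ≥ |a₃|`); no tie / wall exception.

* `mem_cliques_of_mem_A18`, `neg_mem_A18_of_mem_negA18`, `third_sub_third`, `third_neg` — bookkeeping;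
* `fourFamily_main` — closure form: `#cross(P, X∖P) ≤ D(X∖P)` for film `⊆ (1/3)Λ₀`, substrate
  `⊆ Λ₀` closed under the six heads at film-adjacent balls;
* `fourFamilyBarlowFilm_slab` (**rung**, registered by name): slab form `R = 2`, `C = 18432`: for every
  unit `ν` with `⟪hᵢ, ν⟫ ≤ 0` (`i = 1..6`), every `ρ ≥ 2`, every finite unit packing `X ⊇ P` around the
  `ν`-slab sample whose film lies in `(1/3)Λ₀` above the cut.  Films in `(1/3)Λ₀` include every
  mixture of fcc continuation, twins, stacking faults and islands on ALL FOUR `{111}` families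
  simultaneously (and single-family films as a special case, here even at the facet normal).

WHAT THIS IS NOT: the other 23 cones (transport by the cube group = lattice isometries fixing
`(1/3)Λ₀`; next file); off-lattice films; rung F-C1 not moved.
-/

noncomputable section

namespace Summit.Ventures.Crystal3D.Theorems

open Summit.Ventures.Crystal3D Finset
open Literature.MathematicalPhysics.StatisticalMechanics (barlowPos fccStacking barlowOffset layerNormal constHagg
  haggLabel_const mem_barlowStacking_iff contactDeficiency)
open scoped InnerProductSpace

/-- The flattened cost-2 list splits into the six triples of `fourFamilyChamber_cliques`. -/
theorem mem_cliques_of_mem_A18 :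
    ∀ d ∈ ([barlowPos 1 (Real.sqrt (2 / 3)) constHagg 0 1 (-1),
      (1 / 3 : ℝ) • barlowPos 1 (Real.sqrt (2 / 3)) constHagg (-1) 2 (-3),
      (1 / 3 : ℝ) • barlowPos 1 (Real.sqrt (2 / 3)) constHagg (-2) 3 (-2),
      -barlowPos 1 (Real.sqrt (2 / 3)) constHagg 1 0 0,
      (1 / 3 : ℝ) • barlowPos 1 (Real.sqrt (2 / 3)) constHagg (-2) 1 (-2),
      (1 / 3 : ℝ) • barlowPos 1 (Real.sqrt (2 / 3)) constHagg (-3) 2 (-1),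
      -barlowPos 1 (Real.sqrt (2 / 3)) constHagg 0 1 0,
      (1 / 3 : ℝ) • barlowPos 1 (Real.sqrt (2 / 3)) constHagg (-1) (-3) 2,
      (1 / 3 : ℝ) • barlowPos 1 (Real.sqrt (2 / 3)) constHagg (-2) (-2) 1,
      barlowPos 1 (Real.sqrt (2 / 3)) constHagg (-1) 0 1,
      (1 / 3 : ℝ) • barlowPos 1 (Real.sqrt (2 / 3)) constHagg (-2) (-2) 3,
      (1 / 3 : ℝ) • barlowPos 1 (Real.sqrt (2 / 3)) constHagg (-3) (-1) 2,
      -barlowPos 1 (Real.sqrt (2 / 3)) constHagg 0 0 1,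
      (1 / 3 : ℝ) • barlowPos 1 (Real.sqrt (2 / 3)) constHagg 2 (-1) (-3),
      (1 / 3 : ℝ) • barlowPos 1 (Real.sqrt (2 / 3)) constHagg 1 (-2) (-2),
      barlowPos 1 (Real.sqrt (2 / 3)) constHagg (-1) 1 0,
      (1 / 3 : ℝ) • barlowPos 1 (Real.sqrt (2 / 3)) constHagg (-2) 3 1,
      (1 / 3 : ℝ) • barlowPos 1 (Real.sqrt (2 / 3)) constHagg (-3) 2 2] : List (EuclideanSpace ℝ (Fin 3))),
      ∃ k ∈ ([[barlowPos 1 (Real.sqrt (2 / 3)) constHagg 0 1 (-1), (1 / 3 : ℝ) • barlowPos 1 (Real.sqrt (2 / 3)) constHagg (-1) 2 (-3), (1 / 3 : ℝ) • barlowPos 1 (Real.sqrt (2 / 3)) constHagg (-2) 3 (-2)],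
      [-barlowPos 1 (Real.sqrt (2 / 3)) constHagg 1 0 0, (1 / 3 : ℝ) • barlowPos 1 (Real.sqrt (2 / 3)) constHagg (-2) 1 (-2), (1 / 3 : ℝ) • barlowPos 1 (Real.sqrt (2 / 3)) constHagg (-3) 2 (-1)],
      [-barlowPos 1 (Real.sqrt (2 / 3)) constHagg 0 1 0, (1 / 3 : ℝ) • barlowPos 1 (Real.sqrt (2 / 3)) constHagg (-1) (-3) 2, (1 / 3 : ℝ) • barlowPos 1 (Real.sqrt (2 / 3)) constHagg (-2) (-2) 1],
      [barlowPos 1 (Real.sqrt (2 / 3)) constHagg (-1) 0 1, (1 / 3 : ℝ) • barlowPos 1 (Real.sqrt (2 / 3)) constHagg (-2) (-2) 3, (1 / 3 : ℝ) • barlowPos 1 (Real.sqrt (2 / 3)) constHagg (-3) (-1) 2],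
      [-barlowPos 1 (Real.sqrt (2 / 3)) constHagg 0 0 1, (1 / 3 : ℝ) • barlowPos 1 (Real.sqrt (2 / 3)) constHagg 2 (-1) (-3), (1 / 3 : ℝ) • barlowPos 1 (Real.sqrt (2 / 3)) constHagg 1 (-2) (-2)],
      [barlowPos 1 (Real.sqrt (2 / 3)) constHagg (-1) 1 0, (1 / 3 : ℝ) • barlowPos 1 (Real.sqrt (2 / 3)) constHagg (-2) 3 1, (1 / 3 : ℝ) • barlowPos 1 (Real.sqrt (2 / 3)) constHagg (-3) 2 2]] : List (List (EuclideanSpace ℝ (Fin 3)))), d ∈ k := by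
  intro d hd
  rcases hd with _ | ⟨_, hd⟩
  · exact ⟨_, (List.Mem.head _), (List.Mem.head _)⟩
  rcases hd with _ | ⟨_, hd⟩
  · exact ⟨_, (List.Mem.head _), (List.Mem.tail _ (List.Mem.head _))⟩
  rcases hd with _ | ⟨_, hd⟩
  · exact ⟨_, (List.Mem.head _), (List.Mem.tail _ (List.Mem.tail _ (List.Mem.head _)))⟩
  rcases hd with _ | ⟨_, hd⟩
  · exact ⟨_, (List.Mem.tail _ (List.Mem.head _)), (List.Mem.head _)⟩
  rcases hd with _ | ⟨_, hd⟩
  · exact ⟨_, (List.Mem.tail _ (List.Mem.head _)), (List.Mem.tail _ (List.Mem.head _))⟩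
  rcases hd with _ | ⟨_, hd⟩
  · exact ⟨_, (List.Mem.tail _ (List.Mem.head _)), (List.Mem.tail _ (List.Mem.tail _ (List.Mem.head _)))⟩
  rcases hd with _ | ⟨_, hd⟩
  · exact ⟨_, (List.Mem.tail _ (List.Mem.tail _ (List.Mem.head _))), (List.Mem.head _)⟩
  rcases hd with _ | ⟨_, hd⟩
  · exact ⟨_, (List.Mem.tail _ (List.Mem.tail _ (List.Mem.head _))), (List.Mem.tail _ (List.Mem.head _))⟩
  rcases hd with _ | ⟨_, hd⟩
  · exact ⟨_, (List.Mem.tail _ (List.Mem.tail _ (List.Mem.head _))), (List.Mem.tail _ (List.Mem.tail _ (List.Mem.head _)))⟩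
  rcases hd with _ | ⟨_, hd⟩
  · exact ⟨_, (List.Mem.tail _ (List.Mem.tail _ (List.Mem.tail _ (List.Mem.head _)))), (List.Mem.head _)⟩
  rcases hd with _ | ⟨_, hd⟩
  · exact ⟨_, (List.Mem.tail _ (List.Mem.tail _ (List.Mem.tail _ (List.Mem.head _)))), (List.Mem.tail _ (List.Mem.head _))⟩
  rcases hd with _ | ⟨_, hd⟩
  · exact ⟨_, (List.Mem.tail _ (List.Mem.tail _ (List.Mem.tail _ (List.Mem.head _)))), (List.Mem.tail _ (List.Mem.tail _ (List.Mem.head _)))⟩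
  rcases hd with _ | ⟨_, hd⟩
  · exact ⟨_, (List.Mem.tail _ (List.Mem.tail _ (List.Mem.tail _ (List.Mem.tail _ (List.Mem.head _))))), (List.Mem.head _)⟩
  rcases hd with _ | ⟨_, hd⟩
  · exact ⟨_, (List.Mem.tail _ (List.Mem.tail _ (List.Mem.tail _ (List.Mem.tail _ (List.Mem.head _))))), (List.Mem.tail _ (List.Mem.head _))⟩
  rcases hd with _ | ⟨_, hd⟩
  · exact ⟨_, (List.Mem.tail _ (List.Mem.tail _ (List.Mem.tail _ (List.Mem.tail _ (List.Mem.head _))))), (List.Mem.tail _ (List.Mem.tail _ (List.Mem.head _)))⟩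
  rcases hd with _ | ⟨_, hd⟩
  · exact ⟨_, (List.Mem.tail _ (List.Mem.tail _ (List.Mem.tail _ (List.Mem.tail _ (List.Mem.tail _ (List.Mem.head _)))))), (List.Mem.head _)⟩
  rcases hd with _ | ⟨_, hd⟩
  · exact ⟨_, (List.Mem.tail _ (List.Mem.tail _ (List.Mem.tail _ (List.Mem.tail _ (List.Mem.tail _ (List.Mem.head _)))))), (List.Mem.tail _ (List.Mem.head _))⟩
  rcases hd with _ | ⟨_, hd⟩
  · exact ⟨_, (List.Mem.tail _ (List.Mem.tail _ (List.Mem.tail _ (List.Mem.tail _ (List.Mem.tail _ (List.Mem.head _)))))), (List.Mem.tail _ (List.Mem.tail _ (List.Mem.head _)))⟩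
  exact absurd hd List.not_mem_nil

/-- `−((1/3) • pos L) = (1/3) • pos (−L)`. -/
theorem third_neg (K I J : ℤ) :
    -((1 / 3 : ℝ) • barlowPos 1 (Real.sqrt (2 / 3)) constHagg K I J) = (1 / 3 : ℝ) • barlowPos 1 (Real.sqrt (2 / 3)) constHagg (-K) (-I) (-J) := by
  have := barlowPos_zlin (-1) 0 K I J 0 0 0
  simp only [Int.cast_neg, Int.cast_one, neg_smul, one_smul, Int.cast_zero, zero_smul, add_zero,
    neg_mul, one_mul, mul_zero] at this
  rw [← smul_neg, this]

/-- `(1/3) • pos L − (1/3) • pos L' = (1/3) • pos (L − L')`. -/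
theorem third_sub_third (K I J K' I' J' : ℤ) :
    (1 / 3 : ℝ) • barlowPos 1 (Real.sqrt (2 / 3)) constHagg K I J - (1 / 3 : ℝ) • barlowPos 1 (Real.sqrt (2 / 3)) constHagg K' I' J' =
      (1 / 3 : ℝ) • barlowPos 1 (Real.sqrt (2 / 3)) constHagg (K - K') (I - I') (J - J') := by
  have := barlowPos_zlin 1 (-1) K I J K' I' J'
  simp only [Int.cast_one, one_smul, Int.cast_neg, neg_smul, one_mul, neg_mul] at this
  rw [← smul_sub, sub_eq_add_neg, this]
  congr 1

/-- The antipode of a cost-0 direction is a cost-2 direction (same position in the lists). -/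
theorem neg_mem_A18_of_mem_negA18 :
    ∀ d ∈ ([-barlowPos 1 (Real.sqrt (2 / 3)) constHagg 0 1 (-1),
      barlowPos 1 (Real.sqrt (2 / 3)) constHagg 1 0 0,
      barlowPos 1 (Real.sqrt (2 / 3)) constHagg 0 1 0,
      -barlowPos 1 (Real.sqrt (2 / 3)) constHagg (-1) 0 1,
      barlowPos 1 (Real.sqrt (2 / 3)) constHagg 0 0 1,
      -barlowPos 1 (Real.sqrt (2 / 3)) constHagg (-1) 1 0,
      (1 / 3 : ℝ) • barlowPos 1 (Real.sqrt (2 / 3)) constHagg 3 (-2) 1,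
      (1 / 3 : ℝ) • barlowPos 1 (Real.sqrt (2 / 3)) constHagg 2 (-1) 2,
      (1 / 3 : ℝ) • barlowPos 1 (Real.sqrt (2 / 3)) constHagg 2 (-3) 2,
      (1 / 3 : ℝ) • barlowPos 1 (Real.sqrt (2 / 3)) constHagg 1 (-2) 3,
      (1 / 3 : ℝ) • barlowPos 1 (Real.sqrt (2 / 3)) constHagg 3 1 (-2),
      (1 / 3 : ℝ) • barlowPos 1 (Real.sqrt (2 / 3)) constHagg 2 2 (-1),
      (1 / 3 : ℝ) • barlowPos 1 (Real.sqrt (2 / 3)) constHagg 2 2 (-3),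
      (1 / 3 : ℝ) • barlowPos 1 (Real.sqrt (2 / 3)) constHagg 1 3 (-2),
      (1 / 3 : ℝ) • barlowPos 1 (Real.sqrt (2 / 3)) constHagg 3 (-2) (-2),
      (1 / 3 : ℝ) • barlowPos 1 (Real.sqrt (2 / 3)) constHagg 2 (-3) (-1),
      (1 / 3 : ℝ) • barlowPos 1 (Real.sqrt (2 / 3)) constHagg (-1) 2 2,
      (1 / 3 : ℝ) • barlowPos 1 (Real.sqrt (2 / 3)) constHagg (-2) 1 3] : List (EuclideanSpace ℝ (Fin 3))),
      -d ∈ ([barlowPos 1 (Real.sqrt (2 / 3)) constHagg 0 1 (-1),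
      (1 / 3 : ℝ) • barlowPos 1 (Real.sqrt (2 / 3)) constHagg (-1) 2 (-3),
      (1 / 3 : ℝ) • barlowPos 1 (Real.sqrt (2 / 3)) constHagg (-2) 3 (-2),
      -barlowPos 1 (Real.sqrt (2 / 3)) constHagg 1 0 0,
      (1 / 3 : ℝ) • barlowPos 1 (Real.sqrt (2 / 3)) constHagg (-2) 1 (-2),
      (1 / 3 : ℝ) • barlowPos 1 (Real.sqrt (2 / 3)) constHagg (-3) 2 (-1),
      -barlowPos 1 (Real.sqrt (2 / 3)) constHagg 0 1 0,
      (1 / 3 : ℝ) • barlowPos 1 (Real.sqrt (2 / 3)) constHagg (-1) (-3) 2,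
      (1 / 3 : ℝ) • barlowPos 1 (Real.sqrt (2 / 3)) constHagg (-2) (-2) 1,
      barlowPos 1 (Real.sqrt (2 / 3)) constHagg (-1) 0 1,
      (1 / 3 : ℝ) • barlowPos 1 (Real.sqrt (2 / 3)) constHagg (-2) (-2) 3,
      (1 / 3 : ℝ) • barlowPos 1 (Real.sqrt (2 / 3)) constHagg (-3) (-1) 2,
      -barlowPos 1 (Real.sqrt (2 / 3)) constHagg 0 0 1,
      (1 / 3 : ℝ) • barlowPos 1 (Real.sqrt (2 / 3)) constHagg 2 (-1) (-3),
      (1 / 3 : ℝ) • barlowPos 1 (Real.sqrt (2 / 3)) constHagg 1 (-2) (-2),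
      barlowPos 1 (Real.sqrt (2 / 3)) constHagg (-1) 1 0,
      (1 / 3 : ℝ) • barlowPos 1 (Real.sqrt (2 / 3)) constHagg (-2) 3 1,
      (1 / 3 : ℝ) • barlowPos 1 (Real.sqrt (2 / 3)) constHagg (-3) 2 2] : List (EuclideanSpace ℝ (Fin 3))) := by
  intro d hd
  rcases hd with _ | ⟨_, hd⟩
  · rw [neg_neg]
    exact (List.Mem.head _)
  rcases hd with _ | ⟨_, hd⟩
  · exact (List.Mem.tail _ (List.Mem.tail _ (List.Mem.tail _ (List.Mem.head _))))
  rcases hd with _ | ⟨_, hd⟩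
  · exact (List.Mem.tail _ (List.Mem.tail _ (List.Mem.tail _ (List.Mem.tail _ (List.Mem.tail _ (List.Mem.tail _ (List.Mem.head _)))))))
  rcases hd with _ | ⟨_, hd⟩
  · rw [neg_neg]
    exact (List.Mem.tail _ (List.Mem.tail _ (List.Mem.tail _ (List.Mem.tail _ (List.Mem.tail _ (List.Mem.tail _ (List.Mem.tail _ (List.Mem.tail _ (List.Mem.tail _ (List.Mem.head _))))))))))
  rcases hd with _ | ⟨_, hd⟩
  · exact (List.Mem.tail _ (List.Mem.tail _ (List.Mem.tail _ (List.Mem.tail _ (List.Mem.tail _ (List.Mem.tail _ (List.Mem.tail _ (List.Mem.tail _ (List.Mem.tail _ (List.Mem.tail _ (List.Mem.tail _ (List.Mem.tail _ (List.Mem.head _)))))))))))))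
  rcases hd with _ | ⟨_, hd⟩
  · rw [neg_neg]
    exact (List.Mem.tail _ (List.Mem.tail _ (List.Mem.tail _ (List.Mem.tail _ (List.Mem.tail _ (List.Mem.tail _ (List.Mem.tail _ (List.Mem.tail _ (List.Mem.tail _ (List.Mem.tail _ (List.Mem.tail _ (List.Mem.tail _ (List.Mem.tail _ (List.Mem.tail _ (List.Mem.tail _ (List.Mem.head _))))))))))))))))
  rcases hd with _ | ⟨_, hd⟩
  · rw [third_neg 3 (-2) 1]
    simp only [neg_neg]
    exact (List.Mem.tail _ (List.Mem.tail _ (List.Mem.tail _ (List.Mem.tail _ (List.Mem.tail _ (List.Mem.head _))))))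
  rcases hd with _ | ⟨_, hd⟩
  · rw [third_neg 2 (-1) 2]
    simp only [neg_neg]
    exact (List.Mem.tail _ (List.Mem.tail _ (List.Mem.tail _ (List.Mem.tail _ (List.Mem.head _)))))
  rcases hd with _ | ⟨_, hd⟩
  · rw [third_neg 2 (-3) 2]
    simp only [neg_neg]
    exact (List.Mem.tail _ (List.Mem.tail _ (List.Mem.head _)))
  rcases hd with _ | ⟨_, hd⟩
  · rw [third_neg 1 (-2) 3]
    simp only [neg_neg]
    exact (List.Mem.tail _ (List.Mem.head _))
  rcases hd with _ | ⟨_, hd⟩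
  · rw [third_neg 3 1 (-2)]
    simp only [neg_neg]
    exact (List.Mem.tail _ (List.Mem.tail _ (List.Mem.tail _ (List.Mem.tail _ (List.Mem.tail _ (List.Mem.tail _ (List.Mem.tail _ (List.Mem.tail _ (List.Mem.tail _ (List.Mem.tail _ (List.Mem.tail _ (List.Mem.head _))))))))))))
  rcases hd with _ | ⟨_, hd⟩
  · rw [third_neg 2 2 (-1)]
    simp only [neg_neg]
    exact (List.Mem.tail _ (List.Mem.tail _ (List.Mem.tail _ (List.Mem.tail _ (List.Mem.tail _ (List.Mem.tail _ (List.Mem.tail _ (List.Mem.tail _ (List.Mem.head _)))))))))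
  rcases hd with _ | ⟨_, hd⟩
  · rw [third_neg 2 2 (-3)]
    simp only [neg_neg]
    exact (List.Mem.tail _ (List.Mem.tail _ (List.Mem.tail _ (List.Mem.tail _ (List.Mem.tail _ (List.Mem.tail _ (List.Mem.tail _ (List.Mem.tail _ (List.Mem.tail _ (List.Mem.tail _ (List.Mem.head _)))))))))))
  rcases hd with _ | ⟨_, hd⟩
  · rw [third_neg 1 3 (-2)]
    simp only [neg_neg]
    exact (List.Mem.tail _ (List.Mem.tail _ (List.Mem.tail _ (List.Mem.tail _ (List.Mem.tail _ (List.Mem.tail _ (List.Mem.tail _ (List.Mem.head _))))))))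
  rcases hd with _ | ⟨_, hd⟩
  · rw [third_neg 3 (-2) (-2)]
    simp only [neg_neg]
    exact (List.Mem.tail _ (List.Mem.tail _ (List.Mem.tail _ (List.Mem.tail _ (List.Mem.tail _ (List.Mem.tail _ (List.Mem.tail _ (List.Mem.tail _ (List.Mem.tail _ (List.Mem.tail _ (List.Mem.tail _ (List.Mem.tail _ (List.Mem.tail _ (List.Mem.tail _ (List.Mem.tail _ (List.Mem.tail _ (List.Mem.tail _ (List.Mem.head _))))))))))))))))))
  rcases hd with _ | ⟨_, hd⟩
  · rw [third_neg 2 (-3) (-1)]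
    simp only [neg_neg]
    exact (List.Mem.tail _ (List.Mem.tail _ (List.Mem.tail _ (List.Mem.tail _ (List.Mem.tail _ (List.Mem.tail _ (List.Mem.tail _ (List.Mem.tail _ (List.Mem.tail _ (List.Mem.tail _ (List.Mem.tail _ (List.Mem.tail _ (List.Mem.tail _ (List.Mem.tail _ (List.Mem.tail _ (List.Mem.tail _ (List.Mem.head _)))))))))))))))))
  rcases hd with _ | ⟨_, hd⟩
  · rw [third_neg (-1) 2 2]
    simp only [neg_neg]
    exact (List.Mem.tail _ (List.Mem.tail _ (List.Mem.tail _ (List.Mem.tail _ (List.Mem.tail _ (List.Mem.tail _ (List.Mem.tail _ (List.Mem.tail _ (List.Mem.tail _ (List.Mem.tail _ (List.Mem.tail _ (List.Mem.tail _ (List.Mem.tail _ (List.Mem.tail _ (List.Mem.head _)))))))))))))))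
  rcases hd with _ | ⟨_, hd⟩
  · rw [third_neg (-2) 1 3]
    simp only [neg_neg]
    exact (List.Mem.tail _ (List.Mem.tail _ (List.Mem.tail _ (List.Mem.tail _ (List.Mem.tail _ (List.Mem.tail _ (List.Mem.tail _ (List.Mem.tail _ (List.Mem.tail _ (List.Mem.tail _ (List.Mem.tail _ (List.Mem.tail _ (List.Mem.tail _ (List.Mem.head _))))))))))))))
  exact absurd hd List.not_mem_nil

/-- **Closure form of the four-family certificate.**  Film in `(1/3)Λ₀`, substrate in `Λ₀` and
closed under the six heads at film-adjacent balls ⇒ `#cross(P, X∖P) ≤ D(X∖P)`. -/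
theorem fourFamily_main (X P : Finset (EuclideanSpace ℝ (Fin 3)))
    (hX : ∀ p ∈ X, ∀ q ∈ X, p ≠ q → 1 ≤ dist p q) (hPX : P ⊆ X)
    (hPΛ : ∀ p ∈ P, p ∈ fccStacking 1 (Real.sqrt (2 / 3)))
    (hfilm : ∀ q ∈ X \ P, ∃ K I J : ℤ, q = (1 / 3 : ℝ) • barlowPos 1 (Real.sqrt (2 / 3)) constHagg K I J)
    (hclos : ∀ p ∈ P, ∀ q ∈ X \ P, dist p q = 1 →
      ∀ e ∈ ([barlowPos 1 (Real.sqrt (2 / 3)) constHagg 0 1 (-1), -barlowPos 1 (Real.sqrt (2 / 3)) constHagg 1 0 0, -barlowPos 1 (Real.sqrt (2 / 3)) constHagg 0 1 0,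
      barlowPos 1 (Real.sqrt (2 / 3)) constHagg (-1) 0 1, -barlowPos 1 (Real.sqrt (2 / 3)) constHagg 0 0 1, barlowPos 1 (Real.sqrt (2 / 3)) constHagg (-1) 1 0] : List (EuclideanSpace ℝ (Fin 3))), p + e ∈ P) :
    ((((P ×ˢ (X \ P)).filter fun pq => dist pq.1 pq.2 = 1).card : ℕ) : ℝ) ≤
      contactDeficiency (X \ P) := by
  classical
  set A : List (EuclideanSpace ℝ (Fin 3)) := [barlowPos 1 (Real.sqrt (2 / 3)) constHagg 0 1 (-1),
      (1 / 3 : ℝ) • barlowPos 1 (Real.sqrt (2 / 3)) constHagg (-1) 2 (-3),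
      (1 / 3 : ℝ) • barlowPos 1 (Real.sqrt (2 / 3)) constHagg (-2) 3 (-2),
      -barlowPos 1 (Real.sqrt (2 / 3)) constHagg 1 0 0,
      (1 / 3 : ℝ) • barlowPos 1 (Real.sqrt (2 / 3)) constHagg (-2) 1 (-2),
      (1 / 3 : ℝ) • barlowPos 1 (Real.sqrt (2 / 3)) constHagg (-3) 2 (-1),
      -barlowPos 1 (Real.sqrt (2 / 3)) constHagg 0 1 0,
      (1 / 3 : ℝ) • barlowPos 1 (Real.sqrt (2 / 3)) constHagg (-1) (-3) 2,
      (1 / 3 : ℝ) • barlowPos 1 (Real.sqrt (2 / 3)) constHagg (-2) (-2) 1,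
      barlowPos 1 (Real.sqrt (2 / 3)) constHagg (-1) 0 1,
      (1 / 3 : ℝ) • barlowPos 1 (Real.sqrt (2 / 3)) constHagg (-2) (-2) 3,
      (1 / 3 : ℝ) • barlowPos 1 (Real.sqrt (2 / 3)) constHagg (-3) (-1) 2,
      -barlowPos 1 (Real.sqrt (2 / 3)) constHagg 0 0 1,
      (1 / 3 : ℝ) • barlowPos 1 (Real.sqrt (2 / 3)) constHagg 2 (-1) (-3),
      (1 / 3 : ℝ) • barlowPos 1 (Real.sqrt (2 / 3)) constHagg 1 (-2) (-2),
      barlowPos 1 (Real.sqrt (2 / 3)) constHagg (-1) 1 0,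
      (1 / 3 : ℝ) • barlowPos 1 (Real.sqrt (2 / 3)) constHagg (-2) 3 1,
      (1 / 3 : ℝ) • barlowPos 1 (Real.sqrt (2 / 3)) constHagg (-3) 2 2] with hA
  set s : EuclideanSpace ℝ (Fin 3) → ℤ := fun d => if d ∈ A then 1 else 0 with hs
  set t : EuclideanSpace ℝ (Fin 3) → EuclideanSpace ℝ (Fin 3) → ℤ := fun x y => s (x - y) - s (y - x) with ht
  have hs01 : ∀ d, s d = 0 ∨ s d = 1 := fun d => by
    simp only [hs]; split_ifs <;> simp
  have ht_anti : ∀ x y, t x y = -t y x := fun x y => by simp only [ht]; ring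
  have ht_le : ∀ x y, t x y ≤ 1 := fun x y => by
    simp only [ht]; rcases hs01 (x - y) with h | h <;> rcases hs01 (y - x) with h' | h' <;> omega
  -- every ball of `X` is a third-label point
  have hthird : ∀ x ∈ X, ∃ K I J : ℤ, x = (1 / 3 : ℝ) • barlowPos 1 (Real.sqrt (2 / 3)) constHagg K I J := by
    intro x hx
    by_cases hxP : x ∈ P
    · obtain ⟨k, i, j, rfl⟩ := mem_barlowStacking_iff.1 (hPΛ x hxP)
      exact ⟨3 * k, 3 * i, 3 * j, (third_three _ _ _ k i j rfl rfl rfl).symm⟩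
    · exact hfilm x (mem_sdiff.2 ⟨hx, hxP⟩)
  -- direction of any bond inside `X`
  have hdir : ∀ x ∈ X, ∀ y ∈ X, dist x y = 1 → (y - x ∈ A ∨ y - x ∈ ([-barlowPos 1 (Real.sqrt (2 / 3)) constHagg 0 1 (-1),
      barlowPos 1 (Real.sqrt (2 / 3)) constHagg 1 0 0,
      barlowPos 1 (Real.sqrt (2 / 3)) constHagg 0 1 0,
      -barlowPos 1 (Real.sqrt (2 / 3)) constHagg (-1) 0 1,
      barlowPos 1 (Real.sqrt (2 / 3)) constHagg 0 0 1,
      -barlowPos 1 (Real.sqrt (2 / 3)) constHagg (-1) 1 0,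
      (1 / 3 : ℝ) • barlowPos 1 (Real.sqrt (2 / 3)) constHagg 3 (-2) 1,
      (1 / 3 : ℝ) • barlowPos 1 (Real.sqrt (2 / 3)) constHagg 2 (-1) 2,
      (1 / 3 : ℝ) • barlowPos 1 (Real.sqrt (2 / 3)) constHagg 2 (-3) 2,
      (1 / 3 : ℝ) • barlowPos 1 (Real.sqrt (2 / 3)) constHagg 1 (-2) 3,
      (1 / 3 : ℝ) • barlowPos 1 (Real.sqrt (2 / 3)) constHagg 3 1 (-2),
      (1 / 3 : ℝ) • barlowPos 1 (Real.sqrt (2 / 3)) constHagg 2 2 (-1),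
      (1 / 3 : ℝ) • barlowPos 1 (Real.sqrt (2 / 3)) constHagg 2 2 (-3),
      (1 / 3 : ℝ) • barlowPos 1 (Real.sqrt (2 / 3)) constHagg 1 3 (-2),
      (1 / 3 : ℝ) • barlowPos 1 (Real.sqrt (2 / 3)) constHagg 3 (-2) (-2),
      (1 / 3 : ℝ) • barlowPos 1 (Real.sqrt (2 / 3)) constHagg 2 (-3) (-1),
      (1 / 3 : ℝ) • barlowPos 1 (Real.sqrt (2 / 3)) constHagg (-1) 2 2,
      (1 / 3 : ℝ) • barlowPos 1 (Real.sqrt (2 / 3)) constHagg (-2) 1 3] : List (EuclideanSpace ℝ (Fin 3)))) := by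
    intro x hx y hy hd
    obtain ⟨K, I, J, rfl⟩ := hthird x hx
    obtain ⟨K', I', J', rfl⟩ := hthird y hy
    rw [third_sub_third]
    refine third_unit_mem _ _ _ ?_
    rw [← third_sub_third, ← dist_eq_norm, dist_comm, hd]
  have h := adhesion_of_flow X P ∅ hX hPX (empty_subset _) t ht_anti ht_le ?_
  · simpa using h
  intro q hq
  rw [sdiff_empty] at hq
  have hqX : q ∈ X := (mem_sdiff.1 hq).1
  have hqP : q ∉ P := (mem_sdiff.1 hq).2
  refine cliqueRule_T2 X P hX hPX q t (fun x => ht_le x q) [[barlowPos 1 (Real.sqrt (2 / 3)) constHagg 0 1 (-1), (1 / 3 : ℝ) • barlowPos 1 (Real.sqrt (2 / 3)) constHagg (-1) 2 (-3), (1 / 3 : ℝ) • barlowPos 1 (Real.sqrt (2 / 3)) constHagg (-2) 3 (-2)],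
      [-barlowPos 1 (Real.sqrt (2 / 3)) constHagg 1 0 0, (1 / 3 : ℝ) • barlowPos 1 (Real.sqrt (2 / 3)) constHagg (-2) 1 (-2), (1 / 3 : ℝ) • barlowPos 1 (Real.sqrt (2 / 3)) constHagg (-3) 2 (-1)],
      [-barlowPos 1 (Real.sqrt (2 / 3)) constHagg 0 1 0, (1 / 3 : ℝ) • barlowPos 1 (Real.sqrt (2 / 3)) constHagg (-1) (-3) 2, (1 / 3 : ℝ) • barlowPos 1 (Real.sqrt (2 / 3)) constHagg (-2) (-2) 1],
      [barlowPos 1 (Real.sqrt (2 / 3)) constHagg (-1) 0 1, (1 / 3 : ℝ) • barlowPos 1 (Real.sqrt (2 / 3)) constHagg (-2) (-2) 3, (1 / 3 : ℝ) • barlowPos 1 (Real.sqrt (2 / 3)) constHagg (-3) (-1) 2],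
      [-barlowPos 1 (Real.sqrt (2 / 3)) constHagg 0 0 1, (1 / 3 : ℝ) • barlowPos 1 (Real.sqrt (2 / 3)) constHagg 2 (-1) (-3), (1 / 3 : ℝ) • barlowPos 1 (Real.sqrt (2 / 3)) constHagg 1 (-2) (-2)],
      [barlowPos 1 (Real.sqrt (2 / 3)) constHagg (-1) 1 0, (1 / 3 : ℝ) • barlowPos 1 (Real.sqrt (2 / 3)) constHagg (-2) 3 1, (1 / 3 : ℝ) • barlowPos 1 (Real.sqrt (2 / 3)) constHagg (-3) 2 2]] (by simp) fourFamilyChamber_cliques ?_ ?_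
  · -- plugs sit at cost-2 slots
    intro p hp hd
    rcases hdir q hqX p (hPX hp) hd with hA' | hN
    · exact mem_cliques_of_mem_A18 _ hA'
    · exfalso
      obtain ⟨e, he, hlt⟩ := fourFamilyChamber_plugExclusion _ hN
      have hpe : p + e ∈ P := hclos p hp q hq (by rw [dist_comm]; exact hd) e he
      have hne : q ≠ p + e := fun h => hqP (h ▸ hpe)
      have h1 := hX q hqX (p + e) (hPX hpe) hne
      rw [dist_eq_norm, show q - (p + e) = -(p - q + e) by abel, norm_neg] at h1
      linarith
  · -- film partners at slots outside the cliques cost `0`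
    intro x hx hd hno
    have hxX : x ∈ X := (mem_sdiff.1 hx).1
    rcases hdir q hqX x hxX hd with hA' | hN
    · obtain ⟨k, hk, hxk⟩ := mem_cliques_of_mem_A18 _ hA'
      exact absurd hxk (hno k hk)
    · have h1 : s (x - q) = 0 := by
        simp only [hs]
        rw [if_neg]
        intro hmem
        obtain ⟨k, hk, hxk⟩ := mem_cliques_of_mem_A18 _ hmem
        exact hno k hk hxk
      have h2 : s (q - x) = 1 := by
        simp only [hs]
        rw [if_pos]
        rw [show q - x = -(x - q) by abel]
        exact neg_mem_A18_of_mem_negA18 _ hN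
      show s (x - q) - s (q - x) ≤ -1
      rw [h1, h2]; norm_num

/-- **Every film on the refined lattice `(1/3)Λ₀` above the cut satisfies the atom, for every unit
normal in the closed cone `⟪hᵢ, ν⟫ ≤ 0` of the six heads** (`R = 2`, `C = 18432`; registered by name). -/
theorem fourFamilyBarlowFilm_slab :
    ∃ R C : ℝ, 1 ≤ R ∧ ∀ ν : EuclideanSpace ℝ (Fin 3), ‖ν‖ = 1 → ∀ ρ : ℝ, R ≤ ρ →
      ∀ X P : Finset (EuclideanSpace ℝ (Fin 3)),
      (∀ p ∈ X, ∀ q ∈ X, p ≠ q → 1 ≤ dist p q) → P ⊆ X →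
      (∀ p, p ∈ P ↔ (p ∈ fccStacking 1 (Real.sqrt (2 / 3)) ∧ -(2 * R) ≤ ⟪p, ν⟫_ℝ ∧
        ⟪p, ν⟫_ℝ ≤ -R ∧ ‖p‖ ^ 2 - ⟪p, ν⟫_ℝ ^ 2 ≤ ρ ^ 2)) →
      (∀ e ∈ ([barlowPos 1 (Real.sqrt (2 / 3)) constHagg 0 1 (-1), -barlowPos 1 (Real.sqrt (2 / 3)) constHagg 1 0 0, -barlowPos 1 (Real.sqrt (2 / 3)) constHagg 0 1 0,
      barlowPos 1 (Real.sqrt (2 / 3)) constHagg (-1) 0 1, -barlowPos 1 (Real.sqrt (2 / 3)) constHagg 0 0 1, barlowPos 1 (Real.sqrt (2 / 3)) constHagg (-1) 1 0] : List (EuclideanSpace ℝ (Fin 3))), ⟪e, ν⟫_ℝ ≤ 0) →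
      (∀ q ∈ X \ P, ∃ K I J : ℤ, q = (1 / 3 : ℝ) • barlowPos 1 (Real.sqrt (2 / 3)) constHagg K I J) →
      (∀ q ∈ X \ P, -R < ⟪q, ν⟫_ℝ) →
      ((((P ×ˢ (X \ P)).filter fun pq => dist pq.1 pq.2 = 1).card : ℕ) : ℝ) ≤
        contactDeficiency (X \ P) + C * ρ := by
  classical
  refine ⟨2, 18432, by norm_num, fun ν hν ρ hρ X P hX hPX hP hcone hfilm habove => ?_⟩
  refine slabForm_of_localClosure_level ν hν ρ hρ X P hX hPX hP habove fun X' hPX' hX'X hclos' => ?_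
  have hX' : ∀ p ∈ X', ∀ q ∈ X', p ≠ q → 1 ≤ dist p q := fun p hp q hq => hX p (hX'X hp) q (hX'X hq)
  have hPΛ : ∀ p ∈ P, p ∈ fccStacking 1 (Real.sqrt (2 / 3)) := fun p hp => ((hP p).1 hp).1
  have hfilm' : ∀ q ∈ X' \ P, ∃ K I J : ℤ, q = (1 / 3 : ℝ) • barlowPos 1 (Real.sqrt (2 / 3)) constHagg K I J := fun q hq =>
    hfilm q (mem_sdiff.2 ⟨hX'X (mem_sdiff.1 hq).1, (mem_sdiff.1 hq).2⟩)
  refine fourFamily_main X' P hX' hPX' hPΛ hfilm' fun p hp q hq hd e he => ?_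
  have heL : e ∈ ([barlowPos 1 (Real.sqrt (2 / 3)) constHagg 0 1 0, -barlowPos 1 (Real.sqrt (2 / 3)) constHagg 0 1 0,
            barlowPos 1 (Real.sqrt (2 / 3)) constHagg 0 0 1, -barlowPos 1 (Real.sqrt (2 / 3)) constHagg 0 0 1,
            barlowPos 1 (Real.sqrt (2 / 3)) constHagg 0 1 (-1), -barlowPos 1 (Real.sqrt (2 / 3)) constHagg 0 1 (-1),
            barlowPos 1 (Real.sqrt (2 / 3)) constHagg 1 0 0, -barlowPos 1 (Real.sqrt (2 / 3)) constHagg 1 0 0,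
            barlowPos 1 (Real.sqrt (2 / 3)) constHagg (-1) 1 0, -barlowPos 1 (Real.sqrt (2 / 3)) constHagg (-1) 1 0,
            barlowPos 1 (Real.sqrt (2 / 3)) constHagg (-1) 0 1, -barlowPos 1 (Real.sqrt (2 / 3)) constHagg (-1) 0 1] : List (EuclideanSpace ℝ (Fin 3))) := by
    simp only [List.mem_cons, List.mem_nil_iff, or_false] at he
    rcases he with rfl | rfl | rfl | rfl | rfl | rfl <;>
      simp only [List.mem_cons, List.mem_nil_iff, true_or, or_true, or_false]
  exact hclos' p hp q hq hd e heL (hcone e he)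

end Summit.Ventures.Crystal3D.Theorems

end
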